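import Mathlib
import Summits.MatrixMultiplication.MatrixMultiplication.Theses.FourierTwoFamiliesModP
import Summits.MatrixMultiplication.MatrixMultiplication.Theorems.PrimeLogDecay.Negative.LoadBearing

/-!
# The habitat of `PrimeLogDecay` (route `FourierTwoFamiliesModP`, item stmt-MatrixMultiplication-14310)

Support item `PrimeLogDecay` asks for `n·s·(log s)^c ≤ p` for balanced SDPP families in the PRIME
cyclic groups `ℤ/pℤ`.  Neither the primality of the modulus nor the cyclic wrap-around is
load-bearing: balanced SDPP configurations move between `ZMod N`, `ZMod p` and intervals of `ℤ`
along the obvious maps, at the cost of a factor `≤ 4` in the modulus (a Bertrand prime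
`p ∈ (2N, 4N]`), which a log-power bound absorbs by halving `c`.  Kernel-checked here:

* `transfer_zmod`  : `ZMod N → ZMod p` along `x ↦ x.val`, for `p ≥ 2N`
  (adapted from the crux disprover's `lift_design`, `Cruxes/PrimeCyclicPowerGain/Disproof.lean`);
* `transfer_int`   : subsets of `[0, N) ⊂ ℤ` `→ ZMod p` along the cast, for `p ≥ 2N`;
* `transfer_toInt` : `ZMod p → [0, p) ⊂ ℤ` along `x ↦ x.val` (no loss at all);
* `primeLogDecay_iff_cyclicLogDecay` : the item ⇔ the same bound over ALL cyclic groups `ZMod N`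
  (so composite / CRT hosts are admissible for disprovers, and provers may forget primality);
* `primeLogDecay_iff_intLogDecay` (= registered stub `stub_logDecayHabitat`) : the item ⇔ its
  ℤ-INTERVAL form — balanced SDPP families of finite subsets of `[0, N) ⊂ ℤ` have
  `n·s·(log s)^c ≤ N` — the natural habitat of interval / Bohr-set increment arguments
  (no wrap-around; sub-configurations on sub-intervals are again instances).

In each transfer a relation `(a − a') + (b − b') = 0` among images pulls back to the same relation
among preimages (sums of two elements of `[0, N)` are `< 2N ≤ p`), so (W) and (X) — which only
CONCLUDE things from such relations — are preserved, and injectivity preserves balance.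
No new definitions; (W), (X) inlined verbatim as in the route file.
-/

-- the doubled path component `MatrixMultiplication.MatrixMultiplication` is the tree's layout (summit = problem)
set_option linter.dupNamespace false

namespace Summit.MatrixMultiplication.MatrixMultiplication.Theorems.PrimeLogDecay.Habitat

open Summit.MatrixMultiplication.MatrixMultiplication.Theses.FourierTwoFamiliesModP
open Summit.MatrixMultiplication.MatrixMultiplication.Theorems.PrimeLogDecay.Negative
  (PrimeLogDecayWith natCast_inj_of_lt)

section Transfer

/-- From `(a − a') + (b − b') = 0` in `ZMod p` to `a + b = a' + b'` in `ℕ`, when both sums are `< p`. -/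
theorem nat_add_eq_of_rel {p xa xa' xb xb' : ℕ} (h1 : xa + xb < p) (h2 : xa' + xb' < p)
    (h : ((xa : ZMod p) - (xa' : ZMod p)) + ((xb : ZMod p) - (xb' : ZMod p)) = 0) :
    xa + xb = xa' + xb' := by
  rw [sub_add_sub_comm, sub_eq_zero] at h
  apply (natCast_inj_of_lt h1 h2).1
  push_cast
  exact h

/-- **Transfer `ZMod N → ZMod p` (`p ≥ 2N`)** of a balanced SDPP configuration along `x ↦ x.val`
(adapted from `lift_design` in the crux disprover's `Cruxes/PrimeCyclicPowerGain/Disproof.lean`):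
a relation `(a − a') + (b − b') = 0` in `ZMod p` between images forces `a.val + b.val = a'.val + b'.val`
in `ℕ` (both sides `< 2N ≤ p`), hence the same relation in `ZMod N`. -/
theorem transfer_zmod {N : ℕ} (hN : 0 < N) {n s : ℕ} (A B : Fin n → Finset (ZMod N))
    (hbal : ∀ i : Fin n, (A i).card = s ∧ (B i).card = s)
    (hW : ∀ i : Fin n, ∀ a ∈ A i, ∀ a' ∈ A i, ∀ b ∈ B i, ∀ b' ∈ B i,
      (a - a') + (b - b') = 0 → a = a' ∧ b = b')
    (hX : ∀ i j k : Fin n, ∀ a ∈ A i, ∀ a' ∈ A j, ∀ b ∈ B j, ∀ b' ∈ B k,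
      (a - a') + (b - b') = 0 → i = k)
    {p : ℕ} (hp : 2 * N ≤ p) :
    ∃ A' B' : Fin n → Finset (ZMod p), (∀ i : Fin n, (A' i).card = s ∧ (B' i).card = s) ∧
      (∀ i : Fin n, ∀ a ∈ A' i, ∀ a' ∈ A' i, ∀ b ∈ B' i, ∀ b' ∈ B' i,
        (a - a') + (b - b') = 0 → a = a' ∧ b = b') ∧
      (∀ i j k : Fin n, ∀ a ∈ A' i, ∀ a' ∈ A' j, ∀ b ∈ B' j, ∀ b' ∈ B' k,
        (a - a') + (b - b') = 0 → i = k) := by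
  haveI : NeZero N := ⟨hN.ne'⟩
  let f : ZMod N → ZMod p := fun x => ((x.val : ℕ) : ZMod p)
  have hf_inj : Function.Injective f := by
    intro x y hxy
    have := (natCast_inj_of_lt (lt_of_lt_of_le (ZMod.val_lt x) (by omega))
      (lt_of_lt_of_le (ZMod.val_lt y) (by omega))).1 hxy
    exact ZMod.val_injective N this
  have transfer : ∀ x x' z z' : ZMod N,
      (f x - f x') + (f z - f z') = 0 → (x - x') + (z - z') = 0 := by
    intro x x' z z' h
    have hnat := nat_add_eq_of_rel
      (by have := ZMod.val_lt x; have := ZMod.val_lt z; omega)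
      (by have := ZMod.val_lt x'; have := ZMod.val_lt z'; omega) h
    have hc := congrArg (fun m : ℕ => (m : ZMod N)) hnat
    simp only [Nat.cast_add, ZMod.natCast_val, ZMod.cast_id', id_eq] at hc
    rw [sub_add_sub_comm, sub_eq_zero]
    exact hc
  refine ⟨fun i => (A i).image f, fun i => (B i).image f, ?_, ?_, ?_⟩
  · intro i
    simp only [Finset.card_image_of_injective _ hf_inj]
    exact hbal i
  · intro i a ha a' ha' b hb b' hb' hab
    simp only [Finset.mem_image] at ha ha' hb hb'
    obtain ⟨x, hx, rfl⟩ := ha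
    obtain ⟨x', hx', rfl⟩ := ha'
    obtain ⟨z, hz, rfl⟩ := hb
    obtain ⟨z', hz', rfl⟩ := hb'
    obtain ⟨h1, h2⟩ := hW i x hx x' hx' z hz z' hz' (transfer x x' z z' hab)
    exact ⟨by rw [h1], by rw [h2]⟩
  · intro i j k a ha a' ha' b hb b' hb' hab
    simp only [Finset.mem_image] at ha ha' hb hb'
    obtain ⟨x, hx, rfl⟩ := ha
    obtain ⟨x', hx', rfl⟩ := ha'
    obtain ⟨z, hz, rfl⟩ := hb
    obtain ⟨z', hz', rfl⟩ := hb'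
    exact hX i j k x hx x' hx' z hz z' hz' (transfer x x' z z' hab)

/-- **Transfer `ℤ ⊇ [0, N) → ZMod p` (`p ≥ 2N`, `p ≠ 0`)** of a balanced SDPP configuration along
the cast: a relation `(a − a') + (b − b') = 0` in `ZMod p` between images says `p` divides the
integer `(a − a') + (b − b')`, of absolute value `< 2N ≤ p`, which therefore vanishes. -/
theorem transfer_int {N : ℕ} {n s : ℕ} (A B : Fin n → Finset ℤ)
    (hA : ∀ i : Fin n, ∀ a ∈ A i, 0 ≤ a ∧ a < N) (hB : ∀ i : Fin n, ∀ b ∈ B i, 0 ≤ b ∧ b < N)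
    (hbal : ∀ i : Fin n, (A i).card = s ∧ (B i).card = s)
    (hW : ∀ i : Fin n, ∀ a ∈ A i, ∀ a' ∈ A i, ∀ b ∈ B i, ∀ b' ∈ B i,
      (a - a') + (b - b') = 0 → a = a' ∧ b = b')
    (hX : ∀ i j k : Fin n, ∀ a ∈ A i, ∀ a' ∈ A j, ∀ b ∈ B j, ∀ b' ∈ B k,
      (a - a') + (b - b') = 0 → i = k)
    {p : ℕ} [NeZero p] (hp : 2 * N ≤ p) :
    ∃ A' B' : Fin n → Finset (ZMod p), (∀ i : Fin n, (A' i).card = s ∧ (B' i).card = s) ∧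
      (∀ i : Fin n, ∀ a ∈ A' i, ∀ a' ∈ A' i, ∀ b ∈ B' i, ∀ b' ∈ B' i,
        (a - a') + (b - b') = 0 → a = a' ∧ b = b') ∧
      (∀ i j k : Fin n, ∀ a ∈ A' i, ∀ a' ∈ A' j, ∀ b ∈ B' j, ∀ b' ∈ B' k,
        (a - a') + (b - b') = 0 → i = k) := by
  let f : ℤ → ZMod p := fun x => (x : ZMod p)
  have hp2 : (2 * N : ℤ) ≤ p := by exact_mod_cast hp
  have hf_inj : ∀ x y : ℤ, 0 ≤ x → x < N → 0 ≤ y → y < N → f x = f y → x = y := by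
    intro x y hx0 hxN hy0 hyN hxy
    have hdvd : (p : ℤ) ∣ y - x := (ZMod.intCast_eq_intCast_iff_dvd_sub x y p).1 hxy
    have habs : |y - x| < p := by
      rw [abs_lt]; constructor <;> linarith
    have := Int.eq_zero_of_abs_lt_dvd hdvd habs
    linarith
  have transfer : ∀ x x' z z' : ℤ, 0 ≤ x → x < N → 0 ≤ x' → x' < N → 0 ≤ z → z < N →
      0 ≤ z' → z' < N → (f x - f x') + (f z - f z') = 0 → (x - x') + (z - z') = 0 := by
    intro x x' z z' hx0 hxN hx0' hxN' hz0 hzN hz0' hzN' h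
    have h' : (((x - x') + (z - z') : ℤ) : ZMod p) = 0 := by push_cast; exact h
    have hdvd : (p : ℤ) ∣ (x - x') + (z - z') := (ZMod.intCast_zmod_eq_zero_iff_dvd _ p).1 h'
    have habs : |(x - x') + (z - z')| < p := by
      rw [abs_lt]; constructor <;> linarith
    exact Int.eq_zero_of_abs_lt_dvd hdvd habs
  refine ⟨fun i => (A i).image f, fun i => (B i).image f, ?_, ?_, ?_⟩
  · intro i
    refine ⟨?_, ?_⟩
    · rw [Finset.card_image_of_injOn (fun x hx y hy hxy =>
        hf_inj x y (hA i x hx).1 (hA i x hx).2 (hA i y hy).1 (hA i y hy).2 hxy)]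
      exact (hbal i).1
    · rw [Finset.card_image_of_injOn (fun x hx y hy hxy =>
        hf_inj x y (hB i x hx).1 (hB i x hx).2 (hB i y hy).1 (hB i y hy).2 hxy)]
      exact (hbal i).2
  · intro i a ha a' ha' b hb b' hb' hab
    simp only [Finset.mem_image] at ha ha' hb hb'
    obtain ⟨x, hx, rfl⟩ := ha
    obtain ⟨x', hx', rfl⟩ := ha'
    obtain ⟨z, hz, rfl⟩ := hb
    obtain ⟨z', hz', rfl⟩ := hb'
    obtain ⟨h1, h2⟩ := hW i x hx x' hx' z hz z' hz'
      (transfer x x' z z' (hA i x hx).1 (hA i x hx).2 (hA i x' hx').1 (hA i x' hx').2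
        (hB i z hz).1 (hB i z hz).2 (hB i z' hz').1 (hB i z' hz').2 hab)
    exact ⟨by rw [h1], by rw [h2]⟩
  · intro i j k a ha a' ha' b hb b' hb' hab
    simp only [Finset.mem_image] at ha ha' hb hb'
    obtain ⟨x, hx, rfl⟩ := ha
    obtain ⟨x', hx', rfl⟩ := ha'
    obtain ⟨z, hz, rfl⟩ := hb
    obtain ⟨z', hz', rfl⟩ := hb'
    exact hX i j k x hx x' hx' z hz z' hz'
      (transfer x x' z z' (hA i x hx).1 (hA i x hx).2 (hA j x' hx').1 (hA j x' hx').2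
        (hB j z hz).1 (hB j z hz).2 (hB k z' hz').1 (hB k z' hz').2 hab)

/-- **Transfer `ZMod p → ℤ` (`p ≠ 0`)** of a balanced SDPP configuration along `x ↦ (x.val : ℤ)`:
the images lie in `[0, p)`, and an integer relation `(a − a') + (b − b') = 0` between images
reduces mod `p` to the same relation between preimages.  No loss in the modulus. -/
theorem transfer_toInt {p : ℕ} [NeZero p] {n s : ℕ} (A B : Fin n → Finset (ZMod p))
    (hbal : ∀ i : Fin n, (A i).card = s ∧ (B i).card = s)
    (hW : ∀ i : Fin n, ∀ a ∈ A i, ∀ a' ∈ A i, ∀ b ∈ B i, ∀ b' ∈ B i,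
      (a - a') + (b - b') = 0 → a = a' ∧ b = b')
    (hX : ∀ i j k : Fin n, ∀ a ∈ A i, ∀ a' ∈ A j, ∀ b ∈ B j, ∀ b' ∈ B k,
      (a - a') + (b - b') = 0 → i = k) :
    ∃ A' B' : Fin n → Finset ℤ, (∀ i : Fin n, ∀ a ∈ A' i, 0 ≤ a ∧ a < p) ∧
      (∀ i : Fin n, ∀ b ∈ B' i, 0 ≤ b ∧ b < p) ∧
      (∀ i : Fin n, (A' i).card = s ∧ (B' i).card = s) ∧
      (∀ i : Fin n, ∀ a ∈ A' i, ∀ a' ∈ A' i, ∀ b ∈ B' i, ∀ b' ∈ B' i,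
        (a - a') + (b - b') = 0 → a = a' ∧ b = b') ∧
      (∀ i j k : Fin n, ∀ a ∈ A' i, ∀ a' ∈ A' j, ∀ b ∈ B' j, ∀ b' ∈ B' k,
        (a - a') + (b - b') = 0 → i = k) := by
  let f : ZMod p → ℤ := fun x => ((x.val : ℕ) : ℤ)
  have hf_inj : Function.Injective f := by
    intro x y hxy
    apply ZMod.val_injective p
    have hxy' : ((x.val : ℕ) : ℤ) = ((y.val : ℕ) : ℤ) := hxy
    exact_mod_cast hxy'
  have e : ∀ w : ZMod p, ((f w : ℤ) : ZMod p) = w := fun w => by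
    show (((w.val : ℕ) : ℤ) : ZMod p) = w
    rw [Int.cast_natCast, ZMod.natCast_zmod_val]
  have transfer : ∀ x x' z z' : ZMod p,
      (f x - f x') + (f z - f z') = 0 → (x - x') + (z - z') = 0 := by
    intro x x' z z' h
    have hc := congrArg (fun m : ℤ => (m : ZMod p)) h
    simp only [Int.cast_add, Int.cast_sub, Int.cast_zero, e] at hc
    exact hc
  have hrange : ∀ x : ZMod p, 0 ≤ f x ∧ f x < p := fun x =>
    ⟨by show (0 : ℤ) ≤ ((x.val : ℕ) : ℤ); positivity,
     by show ((x.val : ℕ) : ℤ) < (p : ℤ); exact_mod_cast ZMod.val_lt x⟩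
  refine ⟨fun i => (A i).image f, fun i => (B i).image f, ?_, ?_, ?_, ?_, ?_⟩
  · intro i a ha
    simp only [Finset.mem_image] at ha
    obtain ⟨x, _, rfl⟩ := ha
    exact hrange x
  · intro i b hb
    simp only [Finset.mem_image] at hb
    obtain ⟨x, _, rfl⟩ := hb
    exact hrange x
  · intro i
    simp only [Finset.card_image_of_injective _ hf_inj]
    exact hbal i
  · intro i a ha a' ha' b hb b' hb' hab
    simp only [Finset.mem_image] at ha ha' hb hb'
    obtain ⟨x, hx, rfl⟩ := ha
    obtain ⟨x', hx', rfl⟩ := ha'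
    obtain ⟨z, hz, rfl⟩ := hb
    obtain ⟨z', hz', rfl⟩ := hb'
    obtain ⟨h1, h2⟩ := hW i x hx x' hx' z hz z' hz' (transfer x x' z z' hab)
    exact ⟨by rw [h1], by rw [h2]⟩
  · intro i j k a ha a' ha' b hb b' hb' hab
    simp only [Finset.mem_image] at ha ha' hb hb'
    obtain ⟨x, hx, rfl⟩ := ha
    obtain ⟨x', hx', rfl⟩ := ha'
    obtain ⟨z, hz, rfl⟩ := hb
    obtain ⟨z', hz', rfl⟩ := hb'
    exact hX i j k x hx x' hx' z hz z' hz' (transfer x x' z z' hab)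

end Transfer

/-- Thresholds: for `s ≥ ⌈exp (K^{1/c})⌉₊` we have `K ≤ (log s)^c` (`0 < c`, `0 ≤ K`). -/
theorem le_log_rpow_of_ceil_exp_le {c K : ℝ} (hc : 0 < c) (hK : 0 ≤ K) {s : ℕ}
    (hs : ⌈Real.exp (K ^ (c⁻¹))⌉₊ ≤ s) : K ≤ Real.log (s : ℝ) ^ c := by
  have hexp : Real.exp (K ^ (c⁻¹)) ≤ s := le_trans (Nat.le_ceil _) (by exact_mod_cast hs)
  have hs_pos : (0 : ℝ) < s := lt_of_lt_of_le (Real.exp_pos _) hexp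
  have h1 : K ^ (c⁻¹) ≤ Real.log s := (Real.le_log_iff_exp_le hs_pos).2 hexp
  have h2 : (K ^ (c⁻¹)) ^ c ≤ Real.log (s : ℝ) ^ c := Real.rpow_le_rpow (by positivity) h1 hc.le
  rwa [Real.rpow_inv_rpow hK hc.ne'] at h2

/-- Absorbing a factor `4`: from `n·s·(log s)^c ≤ 4M` and `(log s)^{c/2} ≥ 4` conclude
`n·s·(log s)^{c/2} ≤ M` (`0 ≤ c`). -/
theorem absorb_four {c : ℝ} (hc : 0 ≤ c) {n s : ℕ} {M : ℝ}
    (h4 : (4 : ℝ) ≤ Real.log (s : ℝ) ^ (c / 2))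
    (key : (n : ℝ) * (s : ℝ) * Real.log (s : ℝ) ^ c ≤ 4 * M) :
    (n : ℝ) * (s : ℝ) * Real.log (s : ℝ) ^ (c / 2) ≤ M := by
  have hlog_nn : 0 ≤ Real.log (s : ℝ) := Real.log_natCast_nonneg s
  have hsplit : Real.log (s : ℝ) ^ c =
      Real.log (s : ℝ) ^ (c / 2) * Real.log (s : ℝ) ^ (c / 2) := by
    rw [← Real.rpow_add_of_nonneg hlog_nn (by linarith) (by linarith), add_halves]
  rw [hsplit] at key
  have hx : 0 ≤ (n : ℝ) * (s : ℝ) * Real.log (s : ℝ) ^ (c / 2) := by positivity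
  nlinarith [mul_le_mul_of_nonneg_left h4 hx]

/-- **Primality is not load-bearing.** `PrimeLogDecay` holds iff the same log-power bound holds for
balanced SDPP configurations in EVERY cyclic group `ZMod N`, `N ≥ 1` (`→`: transfer to a Bertrand
prime `p ∈ (2N, 4N]` and absorb the factor `4` by `c ↦ c/2`; `←`: specialise). -/
theorem primeLogDecay_iff_cyclicLogDecay :
    PrimeLogDecay ↔ ∃ c : ℝ, 0 < c ∧ ∃ s₀ : ℕ, ∀ N : ℕ, 0 < N →
      ∀ (n s : ℕ) (A B : Fin n → Finset (ZMod N)), s₀ ≤ s →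
      (∀ i : Fin n, (A i).card = s ∧ (B i).card = s) →
      (∀ i : Fin n, ∀ a ∈ A i, ∀ a' ∈ A i, ∀ b ∈ B i, ∀ b' ∈ B i,
        (a - a') + (b - b') = 0 → a = a' ∧ b = b') →
      (∀ i j k : Fin n, ∀ a ∈ A i, ∀ a' ∈ A j, ∀ b ∈ B j, ∀ b' ∈ B k,
        (a - a') + (b - b') = 0 → i = k) →
      (n : ℝ) * (s : ℝ) * Real.log (s : ℝ) ^ c ≤ (N : ℝ) := by
  constructor
  · rintro ⟨c, hc, s₀, h⟩
    have hc2 : 0 < c / 2 := by linarith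
    refine ⟨c / 2, hc2, max s₀ ⌈Real.exp ((4 : ℝ) ^ ((c / 2)⁻¹))⌉₊, ?_⟩
    intro N hN n s A B hs hbal hW hX
    have hs₀ : s₀ ≤ s := le_trans (le_max_left _ _) hs
    have h4 : (4 : ℝ) ≤ Real.log (s : ℝ) ^ (c / 2) :=
      le_log_rpow_of_ceil_exp_le hc2 (by norm_num) (le_trans (le_max_right _ _) hs)
    obtain ⟨p, hp, hNp, hp4N⟩ := Nat.exists_prime_lt_and_le_two_mul (2 * N) (by omega)
    obtain ⟨A', B', hbal', hW', hX'⟩ := transfer_zmod hN A B hbal hW hX (le_of_lt hNp)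
    have key := h p hp n s A' B' hs₀ hbal' hW' hX'
    have hp_le : (p : ℝ) ≤ 4 * (N : ℝ) := by exact_mod_cast (by omega : p ≤ 4 * N)
    exact absorb_four hc.le h4 (key.trans hp_le)
  · rintro ⟨c, hc, s₀, h⟩
    exact ⟨c, hc, s₀, fun p hp n s A B hs hbal hW hX => h p hp.pos n s A B hs hbal hW hX⟩

/-- **The ℤ-interval habitat** (registered stub `stub_logDecayHabitat` of item stmt-14310 is this
statement). `PrimeLogDecay` holds iff for some `c > 0`, `s₀`, every balanced SDPP family of finite
subsets of an interval `[0, N) ⊂ ℤ` with `s ≥ s₀` has `n·s·(log s)^c ≤ N`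
(`→`: transfer to a Bertrand prime `p ∈ (2N, 4N]`, absorb `4` by `c ↦ c/2`; `←`: lift `ZMod p`
to `[0, p)` along `val`, no loss). -/
theorem primeLogDecay_iff_intLogDecay :
    PrimeLogDecay ↔ ∃ c : ℝ, 0 < c ∧ ∃ s₀ : ℕ, ∀ (N n s : ℕ) (A B : Fin n → Finset ℤ), s₀ ≤ s →
      (∀ i : Fin n, ∀ a ∈ A i, 0 ≤ a ∧ a < N) → (∀ i : Fin n, ∀ b ∈ B i, 0 ≤ b ∧ b < N) →
      (∀ i : Fin n, (A i).card = s ∧ (B i).card = s) →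
      (∀ i : Fin n, ∀ a ∈ A i, ∀ a' ∈ A i, ∀ b ∈ B i, ∀ b' ∈ B i,
        (a - a') + (b - b') = 0 → a = a' ∧ b = b') →
      (∀ i j k : Fin n, ∀ a ∈ A i, ∀ a' ∈ A j, ∀ b ∈ B j, ∀ b' ∈ B k,
        (a - a') + (b - b') = 0 → i = k) →
      (n : ℝ) * (s : ℝ) * Real.log (s : ℝ) ^ c ≤ (N : ℝ) := by
  constructor
  · rintro ⟨c, hc, s₀, h⟩
    have hc2 : 0 < c / 2 := by linarith
    refine ⟨c / 2, hc2, max (max s₀ 1) ⌈Real.exp ((4 : ℝ) ^ ((c / 2)⁻¹))⌉₊, ?_⟩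
    intro N n s A B hs hA hB hbal hW hX
    have hs₀ : s₀ ≤ s := le_trans (le_trans (le_max_left _ _) (le_max_left _ _)) hs
    have hs1 : 1 ≤ s := le_trans (le_trans (le_max_right _ _) (le_max_left _ _)) hs
    have h4 : (4 : ℝ) ≤ Real.log (s : ℝ) ^ (c / 2) :=
      le_log_rpow_of_ceil_exp_le hc2 (by norm_num) (le_trans (le_max_right _ _) hs)
    rcases Nat.eq_zero_or_pos N with hN0 | hN
    · -- an empty interval hosts no non-empty block, so `n = 0`
      subst hN0
      rcases Nat.eq_zero_or_pos n with hn0 | hn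
      · subst hn0; simp
      · exfalso
        have hne : (A ⟨0, hn⟩).Nonempty := by
          rw [← Finset.card_pos, (hbal ⟨0, hn⟩).1]; exact hs1
        obtain ⟨a, ha⟩ := hne
        obtain ⟨h0, h1⟩ := hA ⟨0, hn⟩ a ha
        push_cast at h1
        linarith
    · obtain ⟨p, hp, hNp, hp4N⟩ := Nat.exists_prime_lt_and_le_two_mul (2 * N) (by omega)
      haveI : NeZero p := ⟨hp.ne_zero⟩
      obtain ⟨A', B', hbal', hW', hX'⟩ := transfer_int A B hA hB hbal hW hX (le_of_lt hNp)
      have key := h p hp n s A' B' hs₀ hbal' hW' hX'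
      have hp_le : (p : ℝ) ≤ 4 * (N : ℝ) := by exact_mod_cast (by omega : p ≤ 4 * N)
      exact absorb_four hc.le h4 (key.trans hp_le)
  · rintro ⟨c, hc, s₀, h⟩
    refine ⟨c, hc, s₀, ?_⟩
    intro p hp n s A B hs hbal hW hX
    haveI : NeZero p := ⟨hp.ne_zero⟩
    obtain ⟨A', B', hA', hB', hbal', hW', hX'⟩ := transfer_toInt A B hbal hW hX
    exact h p n s A' B' hs hA' hB' hbal' hW' hX'

/-- **Registered form** (stub `stub_logDecayHabitat` of item stmt-14310, signature verbatim):
the ℤ-interval habitat equivalence `primeLogDecay_iff_intLogDecay`. -/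
theorem stub_logDecayHabitat : Summit.MatrixMultiplication.MatrixMultiplication.Theses.FourierTwoFamiliesModP.PrimeLogDecay ↔ ∃ c : ℝ, 0 < c ∧ ∃ s₀ : ℕ, ∀ (N n s : ℕ) (A B : Fin n → Finset ℤ), s₀ ≤ s → (∀ i : Fin n, ∀ a ∈ A i, 0 ≤ a ∧ a < N) → (∀ i : Fin n, ∀ b ∈ B i, 0 ≤ b ∧ b < N) → (∀ i : Fin n, (A i).card = s ∧ (B i).card = s) → (∀ i : Fin n, ∀ a ∈ A i, ∀ a' ∈ A i, ∀ b ∈ B i, ∀ b' ∈ B i, (a - a') + (b - b') = 0 → a = a' ∧ b = b') → (∀ i j k : Fin n, ∀ a ∈ A i, ∀ a' ∈ A j, ∀ b ∈ B j, ∀ b' ∈ B k, (a - a') + (b - b') = 0 → i = k) → (n : ℝ) * (s : ℝ) * Real.log (s : ℝ) ^ c ≤ (N : ℝ) :=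
  primeLogDecay_iff_intLogDecay

end Summit.MatrixMultiplication.MatrixMultiplication.Theorems.PrimeLogDecay.Habitat
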